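/-
Copyright (c) 2026. All rights reserved.
Released under Apache 2.0 license as described in the file LICENSE.
Authors: abc-iut cell, prover seat abc-iut-L4-d2 (gen 9).
-/
import Literature.AnabelianGeometry.AbsoluteAnabelian.GaloisTheatersNumberFieldShadowTFPairsModel
import HarnessLib

/-!
# [AbsTopIII] Def 4.1 at the number-field shadow: MODEL Aut-holomorphic `TF`-pairs and the `TF`-shadow vocabulary with BOTH
# local-pair predicates in print shape

S. Mochizuki, *Topics in absolute anabelian geometry III* [MochizukiAbsTopIII2015], Def 4.1 (i) pp. 101–102 (Kummer structures;
"model Aut-holomorphic `T`-pair"), Def 4.1 (ii) p. 102 (a collection of data `(X ↶κ M)` is an Aut-holomorphic `T`-pair if, among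
other conditions, "(c) for some model Aut-holomorphic `T`-pair `(X_ell ↶κ M_k)` [where the notation is as in (i)], there exist an
isomorphism `X_ell ⥲ X` of objects of `TH` and an isomorphism `M_k ⥲ M` of objects of `T` that are compatible with the respective
Kummer structures"), Def 5.1 (v) p. 117, Cor 5.2 (iv) p. 120.

The `TF`-shadow vocabularies `fieldShadowVocabulary F` (p491073) and `fieldShadowVocabulary' F` (p493095, Def 3.1 (ii) in print
shape at NONARCHIMEDEAN data) both type "`(X ↶κ M)` is an Aut-holomorphic `TF`-pair" as the bare injectivity of `κ` — at which
Cor 5.2 (vi)'s essential surjectivity `PanalocalTPairEssSurj` is refuted by archimedean data `ℤ ↪ A_X` (p504531).  THIS DEF-BEARING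
FILE adds the print-shape ARCHIMEDEAN predicate and the vocabulary carrying both:

* `IsShadowAutHolTFPair κ` — `(X ↶κ M)` is ISOMORPHIC TO A MODEL PAIR `(X(Π, ṽ) ↶ ℚ̄)` of the shadow: there are an infinite place `w`
  of `ℚ̄`, a ring isomorphism `ψ : M ≅ ℚ̄` and a field isomorphism `i : A_X ≅ ℂ` with `i ∘ κ = ι_w ∘ ψ`, `ι_w` the embedding under
  `w` (the orbispace part of the isomorphism is vacuous at the STUB orbispaces);
* `.injective` (it implies the old predicate), `.kummerTransportTF` / `.of_kummerTransportTF` (invariance both ways along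
  isomorphisms of pairs), `isShadowAutHolTFPair_contextKappa` (the canonical archimedean pairs `(X(Π,ṽ) ↶ ℚ̄)` ARE models);
* `fieldShadowVocabulary'' F := { fieldShadowVocabulary F with IsMLFGaloisPair := IsShadowMLFGaloisTFPair,
  IsAutHolPair := IsShadowAutHolTFPair }` and its canonical global `TF`-pair `fieldShadowGlobalTPair'' F` (inhabited).

HONEST LABEL: shadow (`Δ = 1`), algebraic parts of the completions, stub cyclotomes and stub orbispaces; NOT the genuine `(R, W)`
(E-L4-13).  No `instance`/`notation`/attribute changes; nothing here bears on [IUTchIII] Cor. 3.12 or takes a side; typed ≠ proved.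
-/

noncomputable section

open scoped Pointwise Topology
open CategoryTheory NumberField Field

namespace Literature.AnabelianGeometry.AbsoluteAnabelian

namespace NumberFieldShadow

/-! ### Def 4.1: model Aut-holomorphic `TF`-pairs of the shadow -/

/-- **Def 4.1 (ii) at the shadow — "`(X ↶κ M)` is an Aut-holomorphic `TF`-pair"**: it is ISOMORPHIC TO A MODEL PAIR
`(X(Π, ṽ) ↶ ℚ̄)` — there are an infinite place `w` of `ℚ̄`, a ring isomorphism `ψ : M ≅ ℚ̄` and a field isomorphism `i : A_X ≅ ℂ` with
`i (κ m) = ι_w (ψ m)`, `ι_w : ℚ̄ ↪ ℂ` the embedding under `w` (gloss of print's "isomorphic to a model Aut-holomorphic `T`-pair";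
at the stub orbispaces the orbispace component of the isomorphism carries no condition). [cite: MochizukiAbsTopIII2015, Def 4.1 (ii) p.102] -/
def IsShadowAutHolTFPair {X : AutHolOrbispace.{0}} {M : CommRingCat.{0}} (κ : M →+* X.fieldA) : Prop :=
  ∃ (w : InfinitePlace (AlgebraicClosure ℚ)) (ψ : M ≅ CommRingCat.of (AlgebraicClosure ℚ)) (i : X.fieldA ≃+* ℂ),
    ∀ m : M, i (κ m) = w.embedding (ψ.hom.hom m)

namespace IsShadowAutHolTFPair

variable {X Y : AutHolOrbispace.{0}} {M N : CommRingCat.{0}} {κ : M →+* X.fieldA}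

/-- A model Aut-holomorphic `TF`-pair has an INJECTIVE Kummer map (Def 4.1 (i): Kummer structures are injections) — the
print-shape predicate refines the bare one of `fieldShadowVocabulary`. [cite: MochizukiAbsTopIII2015, Def 4.1 (i) p.101] -/
theorem injective (h : IsShadowAutHolTFPair κ) : Function.Injective κ := by
  obtain ⟨w, ψ, i, hi⟩ := h
  intro a b hab
  have h' : w.embedding (ψ.hom.hom a) = w.embedding (ψ.hom.hom b) := by rw [← hi, ← hi, hab]
  have hψ : Function.Injective ψ.hom.hom :=
    (ψ.commRingCatIsoToRingEquiv : (show CommRingCat.{0} from M) ≃+* (CommRingCat.of (AlgebraicClosure ℚ) : CommRingCat.{0})).injective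
  exact hψ (w.embedding.injective h')

/-- **Invariance along isomorphisms of pairs, ascent**: the transport `y_A ∘ κ ∘ φ⁻¹` of a model pair along `(y : X ≅ Y, φ : M ≅ N)`
is a model pair. [cite: MochizukiAbsTopIII2015, Def 4.1 (ii) p.102] -/
theorem kummerTransportTF (h : IsShadowAutHolTFPair κ) (y : AutHolOrbispace.Iso X Y) (φ : M ≅ N) :
    IsShadowAutHolTFPair (NumberFieldShadow.kummerTransportTF y φ κ) := by
  obtain ⟨w, ψ, i, hi⟩ := h
  refine ⟨w, φ.symm ≪≫ ψ, y.fieldIso.symm.trans i, fun n => ?_⟩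
  rw [kummerTransportTF_apply]
  change i (y.fieldIso.symm (y.fieldIso (κ (φ.inv.hom n)))) = w.embedding (ψ.hom.hom (φ.inv.hom n))
  rw [RingEquiv.symm_apply_apply, hi]

/-- **Invariance along isomorphisms of pairs, descent**: if the transport of `κ` along `(y, φ)` is a model pair, so is `κ`.
[cite: MochizukiAbsTopIII2015, Def 4.1 (ii) p.102] -/
theorem of_kummerTransportTF (y : AutHolOrbispace.Iso X Y) (φ : M ≅ N)
    (h : IsShadowAutHolTFPair (NumberFieldShadow.kummerTransportTF y φ κ)) : IsShadowAutHolTFPair κ := by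
  obtain ⟨w, ψ, i, hi⟩ := h
  refine ⟨w, φ ≪≫ ψ, y.fieldIso.trans i, fun m => ?_⟩
  have hm := hi (φ.hom.hom m)
  rw [kummerTransportTF_apply] at hm
  have hφ : φ.inv.hom (φ.hom.hom m) = m := congrArg (fun f : M ⟶ M => f.hom m) φ.hom_inv_id
  rw [hφ] at hm
  exact hm

end IsShadowAutHolTFPair

/-- **The canonical archimedean pairs `(X(Π_E, ṽ) ↶ ℚ̄)` of the shadow ARE model pairs** (`w :=` the place under `ṽ`, `ψ := id`,
`i := id`). [cite: MochizukiAbsTopIII2015, Def 4.1 (ii) p.102] -/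
theorem isShadowAutHolTFPair_contextKappa (E : FundamentalExtension.{0}) (v : (contextProVal E).arc) :
    IsShadowAutHolTFPair (X := contextArchSpace E v) (M := CommRingCat.of (AlgebraicClosure ℚ)) (contextKappa E v) :=
  ⟨contextArcPlace E v, Iso.refl _, RingEquiv.refl ℂ, fun _ => rfl⟩

variable (F : Type) [Field F] [NumberField F]

/-! ### The `TF`-shadow vocabulary with both local-pair predicates in print shape -/

/-- **The `TF`-shadow vocabulary with BOTH local-pair predicates in print shape**: `fieldShadowVocabulary F` with
`IsMLFGaloisPair := IsShadowMLFGaloisTFPair` (Def 3.1 (ii)) and `IsAutHolPair := IsShadowAutHolTFPair` (Def 4.1 (ii)); all other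
data unchanged. [cite: MochizukiAbsTopIII2015, Def 5.1 (v) p.117] -/
def fieldShadowVocabulary'' : TPairVocabulary (context F) .TF :=
  { fieldShadowVocabulary F with
    IsMLFGaloisPair := fun {_} {_} act => IsShadowMLFGaloisTFPair act
    IsAutHolPair := fun {_} {_} κ => IsShadowAutHolTFPair κ }

/-- The doubly primed vocabulary's MLF-Galois-pair predicate is `IsShadowMLFGaloisTFPair`. [cite: MochizukiAbsTopIII2015, Def 3.1 (ii) p.67] -/
theorem fieldShadowVocabulary''_isMLFGaloisPair {D : ProfiniteGrp.{0}} {M : CommRingCat.{0}} (act : D →* Aut M) :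
    (fieldShadowVocabulary'' F).IsMLFGaloisPair act ↔ IsShadowMLFGaloisTFPair act := Iff.rfl

/-- Its Aut-holomorphic-pair predicate is `IsShadowAutHolTFPair`. [cite: MochizukiAbsTopIII2015, Def 4.1 (ii) p.102] -/
theorem fieldShadowVocabulary''_isAutHolPair {X : AutHolOrbispace.{0}} {M : CommRingCat.{0}}
    (κ : (fieldShadowVocabulary'' F).KummerStr X M) :
    (fieldShadowVocabulary'' F).IsAutHolPair κ ↔ IsShadowAutHolTFPair (show (show CommRingCat.{0} from M) →+* X.fieldA from κ) :=
  Iff.rfl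

/-- The canonical archimedean pairs satisfy the doubly primed predicate. [cite: MochizukiAbsTopIII2015, Def 5.1 (v) p.117] -/
theorem isAutHolPair''_locKummer (E : FundamentalExtension.{0}) (v : ((context F).proVal E).arc) :
    (fieldShadowVocabulary'' F).IsAutHolPair ((fieldShadowVocabulary'' F).locKummer E v) :=
  isShadowAutHolTFPair_contextKappa E v

/-- **The canonical global `TF`-pair `M⊚_TF(E_F)` over the doubly primed vocabulary**: it is INHABITED.
[cite: MochizukiAbsTopIII2015, Cor 5.2 (iv) p.120] -/
def fieldShadowGlobalTPair'' : GlobalTPair (fieldShadowVocabulary'' F) :=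
  (fieldShadowVocabulary'' F).canonical (extension F) (isAdmissible_extension F) (isContGlob_fieldGlobAct F _)
    (fun v => isMLFGaloisPair'_fieldLocAct F (isAdmissible_extension F) v) (fun v => isAutHolPair''_locKummer F _ v)

/-- Global `TF`-pairs over the doubly primed vocabulary exist. [cite: MochizukiAbsTopIII2015, Cor 5.2 (iv) p.120] -/
theorem nonempty_globalTPair_fieldShadow'' : Nonempty (GlobalTPair (fieldShadowVocabulary'' F)) :=
  ⟨fieldShadowGlobalTPair'' F⟩

end NumberFieldShadow

end Literature.AnabelianGeometry.AbsoluteAnabelian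

end
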